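import Summits.HodgeConjecture.CorCM.Census.SexticDecicWeil
import Summits.HodgeConjecture.CorCM.Census.SexticOcticWeilDefect
import Mathlib.Algebra.Group.Fin.Basic
import Mathlib.Logic.Equiv.Fin.Rotate
import Mathlib.Tactic.Abel
import HarnessLib

/-!
# `E × T × B` over a sextic and a decic CM field sharing `k`: THE DEFECT LAW from a realised ROTATION of the five decic pairs and
# transitivity on the three sextic pairs — `d₁ ≡ t₁`, `d₃ ≡ t₃`, `e = t₁ + t₃`

COR-CM (cell `pub-hodgecm2`), seat b30 gen 27 (2026-08-23); count-neutral own lane SEXTIC-DECIC, sequel of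
`Census/SexticDecicWeil.lean` (model `PtSD`, `phiSD`, `ModelBalancedSD`, the signed form).  Theorems of the finite model only; no
definition, no named fact, no geometry, no `sorry`, no `decide`.

THE ARGUMENT.  Unknowns: the curve defect `e = N(τ) − N(τ̄)`, the threefold defects `d₁(a)` (`a < 3`), the fivefold defects `d₃(b)`
(`b < 5`).  The signed equation at a realised pair `π = (π₁, π₃)` reads `e + (2 d₁(π₁⁻¹ 0) − Σ d₁) + (2 (d₃(π₃⁻¹ 0) + d₃(π₃⁻¹ 1)) − Σ d₃) = 0`
(`sum_ite_perm_eq`, `sum_ite_pair_eq`).  HYPOTHESES ON `R` (both automatic downstream for the realised pairs of a sextic and a decic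
CM field through `k`, with NO Galois hypothesis): (i) `R` is stable under right translation of the decic component by a ROTATION
`ρ = g ∘ (+1) ∘ g⁻¹` of the five pairs (`hrot`; downstream: a realised `5`-cycle exists by Cauchy's theorem in the transitive group of
realised permutations, gen 23ʼs `DecicWeil23Pair.exists_orderFive_mem_realisedPerms`, and `(π₁, σ)⁶ = (1, σ)`); (ii) every sextic
pair is moved to the pair `0` by some member (`ht`; downstream: `Aut(ℂ)` is transitive on the embeddings of `K₁`).  From (i), the five
equations at `(π₁, π₃ ρʲ)` have the same `e`- and `d₁`-parts, so in the frame `u = d₃ ∘ g`, `π' = π₃ g` the pair sums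
`u(p − j) + u(q − j)` (`π' p = 0`, `π' q = 1`) are constant in `j`; on `ℤ/5` this forces `u` constant (`const_of_pairSums`: two steps of
size `q − p ≠ 0` generate), i.e. `d₃ ≡ t₃`, whence the decic part of EVERY equation is `4t₃ − 5t₃ = −t₃`; from (ii) then `d₁ ≡ t₁`
and `e = 3t₁ − 2t₁ + t₃ = t₁ + t₃`: **`defectSD_of_signed`**.  Conversely the defect law gives the signed equation at EVERY pair of
permutations (`signedSD_of_defectSD`).  On configurations: **`exists_defectSD_of_modelBalancedSD`**, `balancedSD_of_defect`,
`ModelBalancedSD.of_rot`.  (Exact python `work/scratch/census610.py`: nullity `11 = 9 + 2` under every `C₃ × C₅`.)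
[cite: Pohlmann1968, Thm 1] [cite: GaoUllmo2025, Thm 3.1] [cite: MoonenZarhin1995Duke, Thm. 2.4] [cite: DixonMortimer1996, §2.1]

## References
* [Pohlmann1968] H. Pohlmann, Ann. of Math. 88 (1968), Thm 1.  [GaoUllmo2025] Z. Gao, E. Ullmo, J. Inst. Math. Jussieu 25 (2025),
  Thm 3.1.  [MoonenZarhin1995Duke] B. Moonen, Yu. Zarhin, Duke Math. J. 77 (1995), Thm. 2.4.  [DixonMortimer1996] J. D. Dixon,
  B. Mortimer, *Permutation Groups*, GTM 163, §2.1.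
-/

namespace Summit.HodgeConjecture.CorCM.Census.SexticDecicWeil

open Finset
open Summit.HodgeConjecture.CorCM.Census.SexticOcticWeil (sum_ite_perm_eq)

/-! ### The rotation of the five pairs; the signed sum through a pair of positions -/

open Fin.NatCast in
/-- The powers of the rotation `finRotate 5 = (+1)`: `(+1)ʲ c = c + j`. [folklore] -/
theorem finRotate_pow_apply (j c : Fin 5) : ((finRotate 5) ^ (j : ℕ)) c = c + j := by
  have key : ∀ n : ℕ, ((finRotate 5) ^ n) c = c + (n : Fin 5) := fun n => by
    induction n with
    | zero => rw [pow_zero, Equiv.Perm.one_apply, Nat.cast_zero, add_zero]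
    | succ n ih => rw [pow_succ', Equiv.Perm.mul_apply, ih, finRotate_apply, Nat.cast_succ, add_assoc]
  rw [key, Fin.cast_val_eq_self]

/-- The powers of a conjugate rotation `ρ = g (+1) g⁻¹`: `π₃ (ρʲ (g c)) = (π₃ g) (c + j)`. [folklore] -/
theorem mul_conj_finRotate_pow_apply (π₃ g : Equiv.Perm (Fin 5)) (j c : Fin 5) :
    (π₃ * (g * finRotate 5 * g⁻¹) ^ (j : ℕ)) (g c) = (π₃ * g) (c + j) := by
  rw [conj_pow, Equiv.Perm.mul_apply, Equiv.Perm.mul_apply, Equiv.Perm.mul_apply, Equiv.Perm.inv_def, Equiv.symm_apply_apply,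
    finRotate_pow_apply, Equiv.Perm.mul_apply]

/-- **A permutation takes the values `0`, `1` exactly once each**: `Σ_a (σ a ∈ {0,1} ? f a : −f a) = 2 (f p + f q) − Σ f` when
`σ p = 0`, `σ q = 1`. [folklore] -/
theorem sum_ite_pair_eq (σ : Equiv.Perm (Fin 5)) {p q : Fin 5} (hp : σ p = 0) (hq : σ q = 1) (f : Fin 5 → ℤ) :
    ∑ a : Fin 5, (if (σ a = 0 ∨ σ a = 1) then f a else -f a) = 2 * (f p + f q) - ∑ a : Fin 5, f a := by
  have hpq : p ≠ q := fun h => by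
    rw [h, hq] at hp
    exact absurd hp (by decide)
  have key : ∀ a : Fin 5, (if (σ a = 0 ∨ σ a = 1) then f a else -f a) =
      ((if a = p then 2 * f a else 0) + (if a = q then 2 * f a else 0)) - f a := by
    intro a
    by_cases ha : a = p
    · rw [if_pos (Or.inl (by rw [ha, hp])), if_pos ha, if_neg (fun h => hpq (ha.symm.trans h))]; ring
    · by_cases hb : a = q
      · rw [if_pos (Or.inr (by rw [hb, hq])), if_neg ha, if_pos hb]; ring
      · have h' : ¬ (σ a = 0 ∨ σ a = 1) := by
          rintro (h | h)
          · exact ha (σ.injective (h.trans hp.symm))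
          · exact hb (σ.injective (h.trans hq.symm))
        rw [if_neg h', if_neg ha, if_neg hb]; ring
  rw [Finset.sum_congr rfl fun a _ => key a, Finset.sum_sub_distrib, Finset.sum_add_distrib, Finset.sum_ite_eq' Finset.univ p,
    Finset.sum_ite_eq' Finset.univ q, if_pos (Finset.mem_univ p), if_pos (Finset.mem_univ q)]
  ring

/-! ### Constant pair sums along a rotation force a constant function on `ℤ/5` -/

/-- Pair sums `u(−j) + u(m − j)` constant in `j ∈ ℤ/5`, `m ≠ 0` ⟹ `u` constant (the steps `2m` generate `ℤ/5`). [folklore] -/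
theorem const_of_pairSums₀ {u : Fin 5 → ℤ} {m : Fin 5} (hm : m ≠ 0)
    (h : ∀ j : Fin 5, u (0 - j) + u (m - j) = u 0 + u m) (c : Fin 5) : u c = u 0 := by
  have h1 := h 1
  have h2 := h 2
  have h3 := h 3
  have h4 := h 4
  fin_cases m
  · exact absurd rfl hm
  all_goals
    simp only [Fin.reduceFinMk, Fin.isValue, Fin.reduceSub] at h1 h2 h3 h4 ⊢
    fin_cases c <;> simp only [Fin.reduceFinMk, Fin.isValue] <;> linarith

/-- Pair sums `u(p − j) + u(q − j)` constant in `j ∈ ℤ/5`, `p ≠ q` ⟹ `u` constant. [folklore] -/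
theorem const_of_pairSums {u : Fin 5 → ℤ} {p q : Fin 5} (hpq : p ≠ q)
    (h : ∀ j : Fin 5, u (p - j) + u (q - j) = u p + u q) (c : Fin 5) : u c = u p := by
  have hm : q - p ≠ 0 := fun h' => hpq (sub_eq_zero.1 h').symm
  have key := const_of_pairSums₀ (u := fun i => u (p + i)) (m := q - p) hm (fun j => by
    have e1 : p + (0 - j) = p - j := by abel
    have e2 : p + (q - p - j) = q - j := by abel
    have e3 : p + (q - p) = q := by abel
    simp only [e1, e2, e3, add_zero]
    exact h j) (c - p)
  have e4 : p + (c - p) = c := by abel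
  simpa only [e4, add_zero] using key

/-! ### The defect law -/

section Defect

variable {R : Finset (Equiv.Perm (Fin 3) × Equiv.Perm (Fin 5))}

/-- Rotation-stability iterates: `(π₁, π₃ ρⁿ) ∈ R` for all `n`. [folklore] -/
theorem mem_of_rot (g : Equiv.Perm (Fin 5)) (hrot : ∀ π ∈ R, (π.1, π.2 * (g * finRotate 5 * g⁻¹)) ∈ R)
    {π : Equiv.Perm (Fin 3) × Equiv.Perm (Fin 5)} (hπ : π ∈ R) (n : ℕ) : (π.1, π.2 * (g * finRotate 5 * g⁻¹) ^ n) ∈ R := by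
  set ρ : Equiv.Perm (Fin 5) := g * finRotate 5 * g⁻¹
  induction n with
  | zero => rw [pow_zero, mul_one]; exact hπ
  | succ n ih =>
    have h := hrot _ ih
    dsimp only at h
    rw [pow_succ, ← mul_assoc]
    exact h

/-- **The decic sum along the rotation, in the frame `u = d₃ ∘ g`, `π' = π₃ g`**:
`Σ_b (π₃ρʲ b ∈ {0,1} ? d₃ b : −d₃ b) = 2 (u(p − j) + u(q − j)) − Σ u` (`π' p = 0`, `π' q = 1`). [folklore] -/
theorem sum_ite_rot_pow_eq (π₃ g : Equiv.Perm (Fin 5)) (d₃ : Fin 5 → ℤ) (j : Fin 5) {p q : Fin 5} (hp : (π₃ * g) p = 0)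
    (hq : (π₃ * g) q = 1) :
    (∑ b : Fin 5, (if ((π₃ * (g * finRotate 5 * g⁻¹) ^ (j : ℕ)) b = 0 ∨ (π₃ * (g * finRotate 5 * g⁻¹) ^ (j : ℕ)) b = 1)
      then d₃ b else -d₃ b)) =
      2 * (d₃ (g (p - j)) + d₃ (g (q - j))) - ∑ c : Fin 5, d₃ (g c) := by
  -- reindex `b = g c`
  rw [← Equiv.sum_comp g (fun b => if ((π₃ * (g * finRotate 5 * g⁻¹) ^ (j : ℕ)) b = 0 ∨
    (π₃ * (g * finRotate 5 * g⁻¹) ^ (j : ℕ)) b = 1) then d₃ b else -d₃ b)]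
  simp only [mul_conj_finRotate_pow_apply]
  -- reindex `c' = c + j`
  have step : (∑ c : Fin 5, (if ((π₃ * g) (c + j) = 0 ∨ (π₃ * g) (c + j) = 1) then d₃ (g c) else -d₃ (g c))) =
      ∑ c' : Fin 5, (if ((π₃ * g) c' = 0 ∨ (π₃ * g) c' = 1) then d₃ (g (c' - j)) else -d₃ (g (c' - j))) := by
    rw [← Equiv.sum_comp (Equiv.addRight j) (fun c' : Fin 5 => if ((π₃ * g) c' = 0 ∨ (π₃ * g) c' = 1)
      then d₃ (g (c' - j)) else -d₃ (g (c' - j)))]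
    refine Finset.sum_congr rfl fun c _ => ?_
    simp only [Equiv.coe_addRight, add_sub_cancel_right]
  rw [step, sum_ite_pair_eq (π₃ * g) hp hq (fun c' => d₃ (g (c' - j)))]
  congr 1
  exact Equiv.sum_comp (Equiv.subRight j) (fun c : Fin 5 => d₃ (g c))

/-- **THE DEFECT LAW (integer form).**  If `e`, `d₁`, `d₃` satisfy the signed equation at every pair of a set `R` that is stable under
right translation of the decic component by a conjugate rotation (`hrot`) and moves every sextic pair to `0` (`ht`), then `d₁ ≡ t₁`,
`d₃ ≡ t₃` are constant and `e = t₁ + t₃`. [cite: MoonenZarhin1995Duke, Thm. 2.4] [cite: GaoUllmo2025, Thm 3.1] -/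
theorem defectSD_of_signed (g : Equiv.Perm (Fin 5)) (hrot : ∀ π ∈ R, (π.1, π.2 * (g * finRotate 5 * g⁻¹)) ∈ R)
    (ht : ∀ x : Fin 3, ∃ π ∈ R, π.1 x = 0) {e : ℤ} {d₁ : Fin 3 → ℤ} {d₃ : Fin 5 → ℤ}
    (h : ∀ π ∈ R, e + (∑ a : Fin 3, (if π.1 a = 0 then d₁ a else -d₁ a)) +
      (∑ b : Fin 5, (if (π.2 b = 0 ∨ π.2 b = 1) then d₃ b else -d₃ b)) = 0) :
    ∃ t₁ t₃ : ℤ, (∀ a, d₁ a = t₁) ∧ (∀ b, d₃ b = t₃) ∧ e = t₁ + t₃ := by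
  -- a base pair, the frame `u = d₃ ∘ g`, the two positions `p, q` of `π' = π₃ g`
  obtain ⟨π₀, hπ₀, -⟩ := ht 0
  set u : Fin 5 → ℤ := fun c => d₃ (g c) with hu
  have hp : (π₀.2 * g) ((π₀.2 * g).symm 0) = 0 := (π₀.2 * g).apply_symm_apply 0
  have hq : (π₀.2 * g) ((π₀.2 * g).symm 1) = 1 := (π₀.2 * g).apply_symm_apply 1
  have hpq : (π₀.2 * g).symm 0 ≠ (π₀.2 * g).symm 1 := fun hh => by
    have h' := congrArg (π₀.2 * g) hh
    rw [hp, hq] at h'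
    exact absurd h' (by decide)
  -- the pair sums along the rotation are constant
  have hS : ∀ j : Fin 5, u ((π₀.2 * g).symm 0 - j) + u ((π₀.2 * g).symm 1 - j) = u ((π₀.2 * g).symm 0) + u ((π₀.2 * g).symm 1) := by
    intro j
    have h0 := h _ (mem_of_rot g hrot hπ₀ ((0 : Fin 5) : ℕ))
    have hj := h _ (mem_of_rot g hrot hπ₀ (j : ℕ))
    dsimp only at h0 hj
    rw [sum_ite_rot_pow_eq π₀.2 g d₃ 0 hp hq, sub_zero, sub_zero] at h0
    rw [sum_ite_rot_pow_eq π₀.2 g d₃ j hp hq] at hj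
    simp only [hu]
    linarith
  -- hence `d₃` is constant
  have huc : ∀ c, u c = u ((π₀.2 * g).symm 0) := const_of_pairSums hpq hS
  have hd₃ : ∀ b, d₃ b = d₃ (g ((π₀.2 * g).symm 0)) := fun b => by
    have h' := huc (g.symm b)
    simp only [hu, Equiv.apply_symm_apply] at h'
    exact h'
  -- the decic part of every equation is `−t₃`
  have hB : ∀ π₃ : Equiv.Perm (Fin 5), (∑ b : Fin 5, (if (π₃ b = 0 ∨ π₃ b = 1) then d₃ b else -d₃ b)) =
      -d₃ (g ((π₀.2 * g).symm 0)) := by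
    intro π₃
    rw [sum_ite_pair_eq π₃ (π₃.apply_symm_apply 0) (π₃.apply_symm_apply 1) d₃, Finset.sum_congr rfl fun b _ => hd₃ b,
      hd₃ (π₃.symm 0), hd₃ (π₃.symm 1), Finset.sum_const, Finset.card_univ, Fintype.card_fin]
    ring
  -- the equation at a pair moving `x` to `0`
  have heq : ∀ x : Fin 3, e + (2 * d₁ x - ∑ a, d₁ a) - d₃ (g ((π₀.2 * g).symm 0)) = 0 := by
    intro x
    obtain ⟨π, hπ, hx⟩ := ht x
    have h1 := h π hπ
    rw [sum_ite_perm_eq π.1 hx d₁, hB π.2] at h1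
    linarith
  refine ⟨d₁ 0, d₃ (g ((π₀.2 * g).symm 0)), fun a => ?_, hd₃, ?_⟩
  · have h1 := heq a; have h2 := heq 0; linarith
  · have h1 : ∀ a, d₁ a = d₁ 0 := fun a => by have h1 := heq a; have h2 := heq 0; linarith
    have hs₁ : ∑ a, d₁ a = 3 * d₁ 0 := by
      rw [Finset.sum_congr rfl fun a _ => h1 a, Finset.sum_const, Finset.card_univ, Fintype.card_fin]; ring
    have h3 := heq 0
    rw [hs₁] at h3
    linarith

/-- **Conversely, the defect law gives the signed equation at EVERY pair of permutations** (`2t₁ − 3t₁ + 4t₃ − 5t₃ = −(t₁ + t₃)`).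
[folklore] -/
theorem signedSD_of_defectSD {e t₁ t₃ : ℤ} {d₁ : Fin 3 → ℤ} {d₃ : Fin 5 → ℤ} (h₁ : ∀ a, d₁ a = t₁) (h₃ : ∀ b, d₃ b = t₃)
    (he : e = t₁ + t₃) (π : Equiv.Perm (Fin 3) × Equiv.Perm (Fin 5)) :
    e + (∑ a : Fin 3, (if π.1 a = 0 then d₁ a else -d₁ a)) + (∑ b : Fin 5, (if (π.2 b = 0 ∨ π.2 b = 1) then d₃ b else -d₃ b)) = 0 := by
  rw [sum_ite_perm_eq π.1 (π.1.apply_symm_apply 0) d₁, sum_ite_pair_eq π.2 (π.2.apply_symm_apply 0) (π.2.apply_symm_apply 1) d₃,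
    Finset.sum_congr rfl fun a _ => h₁ a, Finset.sum_congr rfl fun b _ => h₃ b, h₁, h₃, h₃, he, Finset.sum_const, Finset.sum_const,
    Finset.card_univ, Finset.card_univ, Fintype.card_fin, Fintype.card_fin]
  ring

end Defect

/-! ### The defect law for configurations -/

section Config

variable {α : Type*} {R : Finset (Equiv.Perm (Fin 3) × Equiv.Perm (Fin 5))} {v : α → PtSD}

/-- **THE DEFECT LAW FOR CONFIGURATIONS.**  For an `R`-balanced configuration, `R` rotation-stable on the decic pairs and transitive on
the sextic pairs: the threefold counts have ONE defect `t₁ = N(1,a,+) − N(1,a,−)` (all `a`), the fivefold counts ONE defect `t₃`, and the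
curve defect is `N(τ) − N(τ̄) = t₁ + t₃`. [cite: MoonenZarhin1995Duke, Thm. 2.4] [cite: GaoUllmo2025, Thm 3.1] -/
theorem exists_defectSD_of_modelBalancedSD (g : Equiv.Perm (Fin 5)) (hrot : ∀ π ∈ R, (π.1, π.2 * (g * finRotate 5 * g⁻¹)) ∈ R)
    (ht : ∀ x : Fin 3, ∃ π ∈ R, π.1 x = 0) {T : Finset α} (hT : ModelBalancedSD R v T) :
    ∃ t₁ t₃ : ℤ,
      (∀ a : Fin 3, ((T.filter fun x => v x = Sum.inr (Sum.inl (a, true))).card : ℤ) -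
        (T.filter fun x => v x = Sum.inr (Sum.inl (a, false))).card = t₁) ∧
      (∀ b : Fin 5, ((T.filter fun x => v x = Sum.inr (Sum.inr (b, true))).card : ℤ) -
        (T.filter fun x => v x = Sum.inr (Sum.inr (b, false))).card = t₃) ∧
      ((T.filter fun x => v x = Sum.inl true).card : ℤ) - (T.filter fun x => v x = Sum.inl false).card = t₁ + t₃ := by
  classical
  exact defectSD_of_signed g hrot ht
    (d₁ := fun a => ((T.filter fun x => v x = Sum.inr (Sum.inl (a, true))).card : ℤ) -
      (T.filter fun x => v x = Sum.inr (Sum.inl (a, false))).card)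
    (d₃ := fun b => ((T.filter fun x => v x = Sum.inr (Sum.inr (b, true))).card : ℤ) -
      (T.filter fun x => v x = Sum.inr (Sum.inr (b, false))).card)
    fun π hπ => signed_of_modelBalancedSD R v hT hπ

/-- **A configuration obeying the defect law is balanced at EVERY pair of permutations** (so under any `R`). [folklore] -/
theorem balancedSD_of_defect {T : Finset α} {t₁ t₃ : ℤ}
    (h₁ : ∀ a : Fin 3, ((T.filter fun x => v x = Sum.inr (Sum.inl (a, true))).card : ℤ) -
      (T.filter fun x => v x = Sum.inr (Sum.inl (a, false))).card = t₁)
    (h₃ : ∀ b : Fin 5, ((T.filter fun x => v x = Sum.inr (Sum.inr (b, true))).card : ℤ) -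
      (T.filter fun x => v x = Sum.inr (Sum.inr (b, false))).card = t₃)
    (he : ((T.filter fun x => v x = Sum.inl true).card : ℤ) - (T.filter fun x => v x = Sum.inl false).card = t₁ + t₃)
    (π : Equiv.Perm (Fin 3) × Equiv.Perm (Fin 5)) :
    2 * (T.filter fun x => v x ∈ phiSD π).card = T.card := by
  classical
  exact balancedSD_of_signed v (signedSD_of_defectSD
    (d₁ := fun a => ((T.filter fun x => v x = Sum.inr (Sum.inl (a, true))).card : ℤ) -
      (T.filter fun x => v x = Sum.inr (Sum.inl (a, false))).card)
    (d₃ := fun b => ((T.filter fun x => v x = Sum.inr (Sum.inr (b, true))).card : ℤ) -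
      (T.filter fun x => v x = Sum.inr (Sum.inr (b, false))).card) h₁ h₃ he π)

/-- **Balanced under a rotation-stable, sextic-transitive `R` ⟹ balanced under every set of pairs** (the defect law does not see `R`).
[folklore] -/
theorem ModelBalancedSD.of_rot (g : Equiv.Perm (Fin 5)) (hrot : ∀ π ∈ R, (π.1, π.2 * (g * finRotate 5 * g⁻¹)) ∈ R)
    (ht : ∀ x : Fin 3, ∃ π ∈ R, π.1 x = 0) {T : Finset α} (hT : ModelBalancedSD R v T)
    (R' : Finset (Equiv.Perm (Fin 3) × Equiv.Perm (Fin 5))) : ModelBalancedSD R' v T := by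
  obtain ⟨t₁, t₃, h₁, h₃, he⟩ := exists_defectSD_of_modelBalancedSD g hrot ht hT
  exact fun π _ => balancedSD_of_defect h₁ h₃ he π

end Config

end Summit.HodgeConjecture.CorCM.Census.SexticDecicWeil
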